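import Mathlib
import Summits.Ventures.HodgeRepro2.T5AdicCompletionMap
import Summits.Ventures.HodgeRepro2.T5AdicCompletionConductor
import Summits.Ventures.HodgeRepro2.T5AdicCompletionInert
import Summits.Ventures.HodgeRepro2.T5UnramifiedCharacter

/-!
# T5AdicCompletionSummary — the local-field dictionary of N5 / N4.1 on Mathlib's number-field
completions, with `w ∣ v` as the ONLY hypothesis

Blind cell pub-hodge-repro2, seat p4 (Tier-5 Lean support, annex growth only).
Declaration per README §8(d): uses an L-value-free non-vanishing device: NO.

Every statement below is a one-line instantiation of an accepted theorem of this seat whose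
continuous-algebra hypotheses `[Algebra Kv Lw] [ContinuousSMul Kv Lw] [IsScalarTower K Kv Lw]`
are now supplied by `T5AdicCompletionMap` (p396218) from `[w.asIdeal.LiesOver v.asIdeal]` alone.
The file exists so that the headline statements can be read in one place with their complete
hypothesis lists: `K ⊆ L` number fields, `v` a finite place of `K`, `w` a finite place of `L`
above `v`, and nothing else.

* `ramificationIdx'_mul_inertiaDeg'_eq_finrank` — `e · f = [Lw : Kv]` (p395866);
* `isIntegralClosure` — `O_Lw` is the integral closure of `O_Kv` in `Lw` (p395866);
* `exists_conductorExp_comp_trace_eq` — the (A6) conductor formula `n(ψ ∘ Tr) = e · n(ψ) + d` for a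
  continuous non-trivial `ψ` (p395990);
* `even_conductorExp_comp_trace_mulLeft` — the (A13) parity at a ramified quadratic place (p395990);
* `exists_character_exact_level_of_quadratic_inert` — the (A10) local half at a quadratic inert
  place (p396319);
* `eq_one_of_unramified_of_trivial_on_base` — E9's forcing fact at an inert place (p396351).

Nothing here is asserted about the Tier-5 datum.
-/

namespace Summit.Ventures.HodgeRepro2.T5AdicCompletionSummary

open IsDedekindDomain HeightOneSpectrum NumberField
open scoped WithZero

variable {K : Type*} [Field K] [NumberField K] (v : HeightOneSpectrum (𝓞 K))
variable {L : Type*} [Field L] [NumberField L] [Algebra K L] (w : HeightOneSpectrum (𝓞 L))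
  [w.asIdeal.LiesOver v.asIdeal]

/-- `e · f = [Lw : Kv]` for `w ∣ v`. -/
theorem ramificationIdx'_mul_inertiaDeg'_eq_finrank (ϖ : v.adicCompletionIntegers K)
    (hϖ : Irreducible ϖ) (π : w.adicCompletionIntegers L) (hπ : Irreducible π) :
    (Ideal.span {ϖ}).ramificationIdx' (Ideal.span {π}) *
        (Ideal.span {ϖ}).inertiaDeg' (Ideal.span {π}) =
      Module.finrank (v.adicCompletion K) (w.adicCompletion L) :=
  T5AdicCompletionIntegral.ramificationIdx'_mul_inertiaDeg'_eq_finrank v w ϖ hϖ π hπ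

/-- `O_Lw` is the integral closure of `O_Kv` in `Lw` for `w ∣ v`. -/
theorem isIntegralClosure :
    IsIntegralClosure (w.adicCompletionIntegers L) (v.adicCompletionIntegers K)
      (w.adicCompletion L) :=
  inferInstance

/-- THE CONDUCTOR FORMULA for `w ∣ v`: for a continuous non-trivial additive character `ψ` of
`Kv`, `n(ψ ∘ Tr_{Lw/Kv}) = e · n(ψ) + d` with `e` the ramification index and `(π ^ d)` the
different. -/
theorem exists_conductorExp_comp_trace_eq (ψ : AddChar (v.adicCompletion K) Circle)
    (hψ : Continuous ψ) (hψ₁ : ∃ y, ψ y ≠ 1) :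
    ∃ (ϖ : v.adicCompletionIntegers K) (π : w.adicCompletionIntegers L) (d : ℕ),
      Irreducible ϖ ∧ Irreducible π ∧
      differentIdeal (v.adicCompletionIntegers K) (w.adicCompletionIntegers L) =
        Ideal.span {π ^ d} ∧
      T5AdditiveConductor.conductorExp
          (ψ.compAddMonoidHom
            (Algebra.trace (v.adicCompletion K) (w.adicCompletion L)).toAddMonoidHom)
          (Valued.v : Valuation (w.adicCompletion L) ℤᵐ⁰) =
        ((Ideal.span {ϖ}).ramificationIdx' (Ideal.span {π}) : ℤ) *
            T5AdditiveConductor.conductorExp ψ (Valued.v : Valuation (v.adicCompletion K) ℤᵐ⁰) +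
          d :=
  T5AdicCompletionConductor.exists_conductorExp_comp_trace_eq v w ψ hψ hψ₁

/-- THE (A13) PARITY for `w ∣ v` at a ramified quadratic place: `n(ψ ∘ Tr ∘ (δ ·))` is even for
`δ = c · √D`. -/
theorem even_conductorExp_comp_trace_mulLeft
    (h2 : Module.finrank (v.adicCompletion K) (w.adicCompletion L) = 2)
    (ψ : AddChar (v.adicCompletion K) Circle) (hψ : Continuous ψ) (hψ₁ : ∃ y, ψ y ≠ 1)
    (π : w.adicCompletionIntegers L) (hπ : Irreducible π) (ϖ : v.adicCompletionIntegers K)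
    (hϖ : Irreducible ϖ) (hf : (Ideal.span {ϖ}).inertiaDeg' (Ideal.span {π}) = 1) (d : ℕ)
    (hd : differentIdeal (v.adicCompletionIntegers K) (w.adicCompletionIntegers L) =
      Ideal.span {π ^ d})
    (s : w.adicCompletionIntegers L) (D : v.adicCompletionIntegers K)
    (hs : s * s = algebraMap (v.adicCompletionIntegers K) (w.adicCompletionIntegers L) D)
    (hs' : s ∉ Set.range (algebraMap (v.adicCompletionIntegers K) (w.adicCompletionIntegers L)))
    (hD : D ≠ 0) (δ : w.adicCompletion L) (c : v.adicCompletion K) (hc : c ≠ 0)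
    (hδ : δ = algebraMap (v.adicCompletion K) (w.adicCompletion L) c *
      algebraMap (w.adicCompletionIntegers L) (w.adicCompletion L) s) :
    Even (T5AdditiveConductor.conductorExp
      ((ψ.compAddMonoidHom
        (Algebra.trace (v.adicCompletion K) (w.adicCompletion L)).toAddMonoidHom).compAddMonoidHom
          (AddMonoidHom.mulLeft δ)) (Valued.v : Valuation (w.adicCompletion L) ℤᵐ⁰)) :=
  T5AdicCompletionConductor.even_conductorExp_comp_trace_mulLeft v w h2 ψ hψ hψ₁ π hπ ϖ hϖ hf d hd
    s D hs hs' hD δ c hc hδ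

/-- THE (A10) LOCAL HALF for `w ∣ v` at a quadratic inert place: characters of `O_Lwˣ` of exact
level `n` trivial on the image of `O_Kvˣ` exist for every `n`. -/
theorem exists_character_exact_level_of_quadratic_inert
    (h2 : Module.finrank (v.adicCompletion K) (w.adicCompletion L) = 2)
    {ϖ : v.adicCompletionIntegers K} (hϖ : Irreducible ϖ)
    (hϖ' : Irreducible (algebraMap (v.adicCompletionIntegers K) (w.adicCompletionIntegers L) ϖ))
    (n : ℕ) :
    ∃ χ : (w.adicCompletionIntegers L)ˣ →* ℂˣ,
      (∀ u ∈ T5PrincipalUnitFiltration.higherUnits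
        (algebraMap (v.adicCompletionIntegers K) (w.adicCompletionIntegers L) ϖ) (n + 1), χ u = 1) ∧
      (∀ r : (v.adicCompletionIntegers K)ˣ, χ (T5PrincipalUnitComparison.unitsMap r) = 1) ∧
      ∃ u ∈ T5PrincipalUnitFiltration.higherUnits
        (algebraMap (v.adicCompletionIntegers K) (w.adicCompletionIntegers L) ϖ) n, χ u ≠ 1 :=
  T5AdicCompletionInert.exists_character_exact_level_of_quadratic_inert v w h2 hϖ hϖ' n

/-- E9 for `w ∣ v` at an inert place: an unramified character of `Lwˣ` trivial on `Kvˣ` is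
trivial. -/
theorem eq_one_of_unramified_of_trivial_on_base {M : Type*} [CommGroup M]
    {ϖ : v.adicCompletionIntegers K} (hϖ : Irreducible ϖ)
    (hϖ' : Irreducible (algebraMap (v.adicCompletionIntegers K) (w.adicCompletionIntegers L) ϖ))
    (χ : (w.adicCompletion L)ˣ →* M)
    (hχ : ∀ u : (w.adicCompletion L)ˣ, Valued.v (u : w.adicCompletion L) = 1 → χ u = 1)
    (hK : ∀ y : (v.adicCompletion K)ˣ, χ (T5UnramifiedCharacter.baseUnits v w y) = 1) : χ = 1 :=
  T5UnramifiedCharacter.eq_one_of_unramified_of_trivial_on_base v w hϖ hϖ' χ hχ hK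

end Summit.Ventures.HodgeRepro2.T5AdicCompletionSummary
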